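import Mathlib
import HarnessLib

/-!
# Non-square descent — THE NON-SQUARE LEVEL MEASURES `λ` (precision P3 of the line card `nonsquare-descent`) for the seed crux
# `SignedMuSeedAtTwoPlus` stmt-BirchSwinnertonDyer-21438 (parent Kμ⁺ `SignedMuVanishingAtTwoPlus` stmt-BirchSwinnertonDyer-20689,
# route ResidualThetaTransportAtTwo)

Cell `bsd-wall`, width seat `bsd-wall-rtt-p4-w2` g17 (`--supports`, closes nothing).  THEOREMS ONLY; BSD is not proved by this and no
number field is named: the statements are about power series over a field `k` (informally `k = 𝔽₄ = 𝒪/2`) acting on a module.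

`Cruxes/SignedMuSeedAtTwoPlus/Lines/nonsquare-descent.md` §P3 («the non-square level measures `λ`»): if `Ē^χ = Λ'·y_∞` is free and the
`y_n` generate, write `u_∞ = f·y_∞`, `Q' = Λ'/(f)`; then `V_n = 𝓔_n^χ/2 = 𝔽₄[G_n]·ȳ_n ≅ 𝔽₄[T]/(T^{2ⁿ})` (because `ω_n ≡ T^{2ⁿ} mod 2`,
`Theorems/…NonsquareDescentTowerNorms.lean`) and `ū_n = f̄·ȳ_n`, so with `μ(f) = 0`:

  `GNS(n) ⟺ ū_n ≠ 0 ⟺ T^{2ⁿ} ∤ f̄ ⟺ λ := ord_T(f mod 2) < 2ⁿ`,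

«the first non-square level is `m₀ = min{m : 2^m > λ}`» and «an observed GNS(m) gives `λ < 2^m`».  Here, for a field `k`, a power
series `g ∈ k⟦X⟧` (informally `f̄ = f mod 2`) and a `k⟦X⟧`-module `V` with an element `y` (informally `ȳ_n`) of annihilator EXACTLY
`(X^N)` (`N = 2ⁿ`):

* §1 `X_pow_dvd_iff_le_order` — `X^N ∣ g ↔ N ≤ ord g` (any semiring `k`); `order_lt_iff_toNat_lt` (for `g ≠ 0` the order is the natural
  number `λ = (ord g).toNat`).
* §2 `dvd_of_smul_eq_zero_of_X_pow_smul_ne_zero` — over `k⟦X⟧` (`k` a field) an element `y` with `X^{N−1} • y ≠ 0` has annihilator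
  contained in `(X^N)` (every non-zero power series is `X^a·unit`); so «free of rank one over `k[T]/(T^N)`» may be fed as the single
  bit `X^{N−1} ȳ_n ≠ 0`.
* §3 **`smul_ne_zero_iff_order_lt`** — for `y` with annihilator exactly `(X^N)`: `g • y ≠ 0 ↔ ord g < N` (**GNS(n) ⟺ λ < 2ⁿ**);
  `smul_ne_zero_mono` (GNS(n) ⇒ GNS(n') for `2ⁿ ≤ 2^{n'}` in this model); `exists_order_lt_two_pow` (`g ≠ 0`, i.e. `μ = 0`, ⇒ `ord g < 2^m`
  for some `m`: a non-square level EXISTS); `order_lt_of_smul_ne_zero` (an observed non-square at level `N` bounds `λ < N` — (iii) of P3).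
* §4 `map_smul_ne_zero_iff_order_map_lt` — the same through a reduction map `π : 𝒪 →+* k` for `f ∈ 𝒪⟦X⟧` acting through `f̄ = f.map π`
  (the dictionary `λ(Q') = ord_T(f mod 2)`).

[folklore]
-/

set_option autoImplicit false
-- the Theorems namespace of this sub repeats the summit name by design (D-0017 nested layout)
set_option linter.dupNamespace false

namespace Summit.BirchSwinnertonDyer.BirchSwinnertonDyer.Theorems.SignedMuAtTwo.NonsquareDescent

open PowerSeries

/-! ## §1 `X^N ∣ g ↔ N ≤ ord g` -/

section Order

variable {k : Type*} [Semiring k]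

/-- `X^N ∣ g ↔ N ≤ ord g` for a power series `g`. [folklore] -/
theorem X_pow_dvd_iff_le_order (g : PowerSeries k) (N : ℕ) :
    (X : PowerSeries k) ^ N ∣ g ↔ (N : ℕ∞) ≤ g.order := by
  rw [PowerSeries.X_pow_dvd_iff]
  refine ⟨fun h => nat_le_order g N h, fun h m hm => coeff_of_lt_order m ?_⟩
  exact lt_of_lt_of_le (by exact_mod_cast hm) h

/-- `¬ X^N ∣ g ↔ ord g < N`. [folklore] -/
theorem not_X_pow_dvd_iff_order_lt (g : PowerSeries k) (N : ℕ) :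
    ¬ (X : PowerSeries k) ^ N ∣ g ↔ g.order < (N : ℕ∞) := by
  rw [X_pow_dvd_iff_le_order, not_le]

/-- For `g ≠ 0` the order is a natural number `λ = (ord g).toNat`, and `ord g < N ↔ λ < N`. [folklore] -/
theorem order_lt_iff_toNat_lt {g : PowerSeries k} (hg : g ≠ 0) (N : ℕ) :
    g.order < (N : ℕ∞) ↔ g.order.toNat < N := by
  have hfin : g.order ≠ ⊤ := fun h => hg (order_eq_top.mp h)
  conv_lhs => rw [← ENat.coe_toNat hfin]
  exact_mod_cast Iff.rfl

end Order

/-! ## §2 Annihilators in a `k⟦X⟧`-module from one non-vanishing bit -/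

section Ann

variable {k : Type*} [Field k] {V : Type*} [AddCommGroup V] [Module (PowerSeries k) V]

/-- **One bit gives the annihilator.**  Over `k⟦X⟧` (`k` a field), if `X^{N-1} • y ≠ 0` then every `g` with `g • y = 0` is divisible by
`X^N` (write `g = X^a · w` with `w` a unit; `X^a • y = 0` forces `a ≥ N`). [folklore] -/
theorem dvd_of_smul_eq_zero_of_X_pow_smul_ne_zero {y : V} {N : ℕ} (hy : (X : PowerSeries k) ^ (N - 1) • y ≠ 0)
    {g : PowerSeries k} (hg : g • y = 0) : (X : PowerSeries k) ^ N ∣ g := by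
  by_cases hg0 : g = 0
  · rw [hg0]; exact dvd_zero _
  have hfac : (X : PowerSeries k) ^ g.order.toNat * divXPowOrder g = g := X_pow_order_mul_divXPowOrder
  have hunit : IsUnit (divXPowOrder g) := isUnit_divided_by_X_pow_order hg0
  have hXa : (X : PowerSeries k) ^ g.order.toNat • y = 0 := by
    rw [← hfac, mul_comm, mul_smul, hunit.smul_eq_zero] at hg
    exact hg
  have hle : N ≤ g.order.toNat := by
    by_contra hlt
    push Not at hlt
    apply hy
    have hsplit : (X : PowerSeries k) ^ (N - 1) = X ^ (N - 1 - g.order.toNat) * X ^ g.order.toNat := by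
      rw [← pow_add]; congr 1; omega
    rw [hsplit, mul_smul, hXa, smul_zero]
  exact (pow_dvd_pow X hle).trans X_pow_order_dvd

/-- Hence, with `X^N • y = 0` as well, the annihilator of `y` is EXACTLY `(X^N)`: `g • y = 0 ↔ X^N ∣ g`. [folklore] -/
theorem smul_eq_zero_iff_X_pow_dvd {y : V} {N : ℕ} (hy0 : (X : PowerSeries k) ^ N • y = 0)
    (hy : (X : PowerSeries k) ^ (N - 1) • y ≠ 0) (g : PowerSeries k) :
    g • y = 0 ↔ (X : PowerSeries k) ^ N ∣ g := by
  refine ⟨dvd_of_smul_eq_zero_of_X_pow_smul_ne_zero hy, fun ⟨r, hr⟩ => ?_⟩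
  rw [hr, mul_comm, mul_smul, hy0, smul_zero]

end Ann

/-! ## §3 `GNS(n) ⟺ λ < 2ⁿ` -/

section Lambda

variable {k : Type*} [Field k] {V : Type*} [AddCommGroup V] [Module (PowerSeries k) V]

/-- **`GNS(n) ⟺ λ < 2ⁿ`** (precision P3): for `y` with annihilator exactly `(X^N)` (`ȳ_n`, `N = 2ⁿ`) and any `g` (`f̄ = f mod 2`),
`g • y ≠ 0 ↔ ord g < N`. [folklore] -/
theorem smul_ne_zero_iff_order_lt {y : V} {N : ℕ} (hann : ∀ g : PowerSeries k, g • y = 0 ↔ (X : PowerSeries k) ^ N ∣ g)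
    (g : PowerSeries k) : g • y ≠ 0 ↔ g.order < (N : ℕ∞) := by
  rw [Ne, hann, not_X_pow_dvd_iff_order_lt]

/-- The same with the annihilator supplied by the two bits `X^N • y = 0`, `X^{N−1} • y ≠ 0`. [folklore] -/
theorem smul_ne_zero_iff_order_lt' {y : V} {N : ℕ} (hy0 : (X : PowerSeries k) ^ N • y = 0)
    (hy : (X : PowerSeries k) ^ (N - 1) • y ≠ 0) (g : PowerSeries k) :
    g • y ≠ 0 ↔ g.order < (N : ℕ∞) :=
  smul_ne_zero_iff_order_lt (smul_eq_zero_iff_X_pow_dvd hy0 hy) g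

/-- **An observed non-square bounds `λ`** ((iii) of P3): if `g • y ≠ 0` for some `y` killed by `X^N`, then `g ≠ 0` (`μ = 0` in the
model) and `ord g < N`. [folklore] -/
theorem order_lt_of_smul_ne_zero {y : V} {N : ℕ} (hy0 : (X : PowerSeries k) ^ N • y = 0) {g : PowerSeries k}
    (hg : g • y ≠ 0) : g ≠ 0 ∧ g.order < (N : ℕ∞) := by
  refine ⟨fun h => hg (by rw [h, zero_smul]), ?_⟩
  rw [← not_X_pow_dvd_iff_order_lt]
  rintro ⟨r, hr⟩
  exact hg (by rw [hr, mul_comm, mul_smul, hy0, smul_zero])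

/-- **Monotonicity in the level** (GNS(n) ⇒ GNS(n') in the model): if `ord g < N ≤ N'` and `y'` has annihilator exactly `(X^{N'})`, then
`g • y' ≠ 0`. [folklore] -/
theorem smul_ne_zero_mono {y' : V} {N N' : ℕ} (hNN' : N ≤ N')
    (hann' : ∀ g : PowerSeries k, g • y' = 0 ↔ (X : PowerSeries k) ^ N' ∣ g) {g : PowerSeries k}
    (hg : g.order < (N : ℕ∞)) : g • y' ≠ 0 := by
  rw [smul_ne_zero_iff_order_lt hann']
  exact lt_of_lt_of_le hg (by exact_mod_cast hNN')

/-- **A non-square level exists when `μ = 0`**: for `g ≠ 0` there is `m` with `ord g < 2^m` (so `g • ȳ_m ≠ 0` at every level `m` with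
`2^m > λ`; the first such `m` is the card's `m₀ = min{m : 2^m > λ}`). [folklore] -/
theorem exists_order_lt_two_pow {g : PowerSeries k} (hg : g ≠ 0) : ∃ m : ℕ, g.order < ((2 ^ m : ℕ) : ℕ∞) := by
  refine ⟨g.order.toNat, ?_⟩
  rw [order_lt_iff_toNat_lt hg]
  exact Nat.lt_two_pow_self

/-- The level criterion as a natural-number inequality: for `g ≠ 0` with `λ = (ord g).toNat` and `y` of annihilator exactly `(X^N)`,
`g • y ≠ 0 ↔ λ < N`. [folklore] -/
theorem smul_ne_zero_iff_toNat_lt {y : V} {N : ℕ} (hann : ∀ g : PowerSeries k, g • y = 0 ↔ (X : PowerSeries k) ^ N ∣ g)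
    {g : PowerSeries k} (hg : g ≠ 0) : g • y ≠ 0 ↔ g.order.toNat < N := by
  rw [smul_ne_zero_iff_order_lt hann, order_lt_iff_toNat_lt hg]

end Lambda

/-! ## §4 Through a reduction map: `λ(Q') = ord_T(f mod ϖ)` -/

section Reduction

variable {𝒪 k : Type*} [CommRing 𝒪] [Field k] {V : Type*} [AddCommGroup V] [Module (PowerSeries k) V]

/-- **`GNS(n) ⟺ ord_T(f mod ϖ) < 2ⁿ`** with the reduction explicit: for `π : 𝒪 →+* k` (the residue map of `𝒪 = ℤ₂[ζ₃]`), `f ∈ 𝒪⟦X⟧`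
acting on `V` (`= 𝓔_n^χ/2`) through `f̄ = f.map π`, and `y` of annihilator exactly `(X^N)`: `f̄ • y ≠ 0 ↔ ord f̄ < N`. [folklore] -/
theorem map_smul_ne_zero_iff_order_map_lt (π : 𝒪 →+* k) {y : V} {N : ℕ}
    (hann : ∀ g : PowerSeries k, g • y = 0 ↔ (X : PowerSeries k) ^ N ∣ g) (f : PowerSeries 𝒪) :
    (PowerSeries.map π f) • y ≠ 0 ↔ (PowerSeries.map π f).order < (N : ℕ∞) :=
  smul_ne_zero_iff_order_lt hann _

/-- `μ = 0` in this currency is `f.map π ≠ 0` (some coefficient of `f` is not in `ker π`); then a non-square level exists: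
`∃ m, ord (f.map π) < 2^m`. [folklore] -/
theorem exists_order_map_lt_two_pow (π : 𝒪 →+* k) {f : PowerSeries 𝒪} (hf : PowerSeries.map π f ≠ 0) :
    ∃ m : ℕ, (PowerSeries.map π f).order < ((2 ^ m : ℕ) : ℕ∞) :=
  exists_order_lt_two_pow hf

/-- `f.map π ≠ 0 ↔` some coefficient of `f` survives reduction. [folklore] -/
theorem map_ne_zero_iff_exists_coeff (π : 𝒪 →+* k) (f : PowerSeries 𝒪) :
    PowerSeries.map π f ≠ 0 ↔ ∃ n : ℕ, π (PowerSeries.coeff n f) ≠ 0 := by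
  rw [Ne, PowerSeries.ext_iff, not_forall]
  simp only [PowerSeries.coeff_map, map_zero]

end Reduction

end Summit.BirchSwinnertonDyer.BirchSwinnertonDyer.Theorems.SignedMuAtTwo.NonsquareDescent
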